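import Summits.RiemannHypothesis.RiemannHypothesis.Theorems.NymanBeurlingTailLeaf
import Summits.RiemannHypothesis.RiemannHypothesis.Theses.NymanBeurlingTail
import HarnessLib

/-!
# RiemannHypothesis / NymanBeurlingTail — item `NbKeyOrthogonality` closed BY NAME (RH-FREE per N)

Route `RiemannHypothesis/NymanBeurlingTail` (cell `pub/rh-li`, rung L-P(P2); proofs rh-li-theory gen 4, filed by the
prover seat).  Substance: `NbTheory.nbKeyOrthogonality_holds` (`NymanBeurlingTailLeaf.lean`).
RH-FREE (per `N`); nothing here bears on the truth of RH.
-/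

noncomputable section

-- D-0017: `Summit.<S>.<S>.…` is the designed namespace of a single-problem summit.
set_option linter.dupNamespace false

namespace Summit.RiemannHypothesis.RiemannHypothesis.Theorems.NbTheory

/-- **Item `NbKeyOrthogonality` of route `NymanBeurlingTail` — PROVED** (the route decl by name). -/
theorem nbKeyOrthogonality_proof : Summit.RiemannHypothesis.RiemannHypothesis.Theses.NymanBeurlingTail.NbKeyOrthogonality :=
  nbKeyOrthogonality_holds

end Summit.RiemannHypothesis.RiemannHypothesis.Theorems.NbTheory

end
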